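import Summits.Ventures.CertifiedArithmetic.Expansions.WeakExpansionClosure
import Mathlib.Tactic.Linarith
import Mathlib.Tactic.Positivity
import Mathlib.Tactic.Ring
import Mathlib.Tactic.NormNum

/-!
# Weakly nonoverlapping expansions, part 13: FAST-EXPANSION-SUM is correct for EVERY admissible
# merge order

HONEST FRAMING (ENGINES group, unit `eng-quad-4`, kernels lane of the `certquad` engine — shared
numerical engines serving client cells; rigour lives in the verifiers; every published number
belongs to a client cell's ledger, not to the engines group): NEW WORK of the lane's Lean line, not a
published result, hence under `Summits/Ventures/` with no citation tag; nothing here is cited anywhere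
as a literature fact.  Overview of the development: module docstring of `WeakExpansion.lean`.

MOTIVATION.  Line 1 of FAST-EXPANSION-SUM [Shewchuk1997, Thm 13 p. 320] says "merge `e` and `f`
into a single sequence `g`, in order of nondecreasing magnitude (possibly with interspersed
zeros)".  When two components have EQUAL magnitude the merged order is not determined by this
sentence, and implementations differ: the tree's `mergeExpansions` (a stable `List.merge` by `|·|`)
puts the component of `e` first, whereas the public-domain `predicates.c`
(`fast_expansion_sum[_zeroelim]`) takes `enow` iff `(fnow > enow) == (fnow > -enow)`, which on a
tie `|enow| = |fnow| ≠ 0` takes `fnow` first exactly when `fnow > 0` (part 14,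
`FastExpansionSumPredicates.lean`).  The two orders feed TWO-SUM different operand sequences and can
produce different (equally valid) output expansions.  Theorems 1–2 of this development
(`fastExpansionSum_nonoverlapping_of_isWeakExpansion`, `fastExpansionSum_isWeakExpansion`) were
stated for `mergeExpansions`; this file shows that NOTHING in them depends on the tie rule.

CONTENTS.
* `IsMerge g e f` — the ADMISSIBLE MERGES: `g` interleaves `e` and `f` (each in its own order) and
  every component, when taken, does not exceed in magnitude any NONZERO component still pending in
  the other list; `mergeExpansions` is admissible on inputs sorted by magnitude except zeros
  (`isMerge_mergeExpansions`), and so is `predicates.c`'s merge (part 14).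
* `fastExpansionSumOn fl g` — Lines 2–5 of FAST-EXPANSION-SUM run on a given merged sequence;
  `fastExpansionSum fl e f = fastExpansionSumOn fl (mergeExpansions e f)` (`fastExpansionSum_eq_on`);
  on an admissible merge it is the all-TWO-SUM chain `growExpansion fl ⟨g₂,…⟩ g₁`
  (`fastExpansionSumOn_eq_growExpansion`) — so an implementation that uses TWO-SUM instead of
  FAST-TWO-SUM for the second component (as `predicates.c` does when one input is already
  exhausted) computes the same list.
* THEOREM 2′ `fastExpansionSumOn_spec`: for `p ≥ 4` and any round-to-nearest with `RoundoffBelow 2`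
  (e.g. round-half-even), for EVERY admissible merge `g` of two weakly nonoverlapping expansions of
  floats, `fastExpansionSumOn fl g` is a weakly nonoverlapping (hence nonoverlapping, increasing)
  expansion of `m + n` floats with sum `Σe + Σf` exactly.  The proof re-runs the induction of part 6
  (`FesInvW.isWeakExpansion_growExpansion`) with the coupling "`rs = mergeExpansions e₂ f₂`" replaced
  by "`IsMerge rs e₂ f₂`" (`FesInvW.advanceM`, `FesInvW.isWeakExpansion_growExpansion_of_isMerge`);
  the loop-step lemmas of parts 4–6 (`FesInvW.step`, `FesInvW.adjFacts`) were already order-free.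
  `fastExpansionSum_spec_of_isWeakExpansion` recovers Theorems 1–2 as the instance
  `g = mergeExpansions e f`.

EXAMPLE (precision 6, round-half-even): `e = ⟨2, −256⟩`, `f = ⟨2, 256⟩`.  The tree merges to
`g = ⟨2, 2, −256, 256⟩` and returns `h = ⟨0, 0, 0, 4⟩`; the admissible merge `g = ⟨2, 2, 256, −256⟩`
(`predicates.c`'s) gives `h = ⟨0, 4, 0, 0⟩` (`4 ⊕ 256 = 256` by the even tie, roundoff `4`; then
`256 ⊖ 256 = 0`).  Different lists, both weakly nonoverlapping with sum `4`.

EVIDENCE GATHERED BEFORE THE PROOF (informal, exact rational model of both merges; evidence only):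
random pairs of weakly nonoverlapping expansions with forced magnitude ties, `p = 6 / 8 / 11 / 24`,
3000 pairs each (≈ 1570 with a nonzero tie): the two merges differ on 708 / 755 / 716 / 701 pairs, the
OUTPUT lists differ on 2 / 1 / 0 / 0 pairs, both merges admissible (`IsMerge`, checked by dynamic
programming over interleavings) on all pairs, every output weakly nonoverlapping with the exact sum.
-/

namespace Summit.Ventures.CertifiedArithmetic.Expansions

open Literature.ComputerArithmetic.JeannerodRump2018
open Literature.ComputerArithmetic.BoldoJeannerodMelquiondMuller2023 hiding twoSum twoSum_fst isFloat_twoSum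
open Literature.ComputerArithmetic.Shewchuk1997

variable {p : ℕ} {emin : ℤ} {fl : ℚ → ℚ}

/-! ## Admissible merges -/

/-- `IsMerge g e f`: `g` is an interleaving of `e` and `f` in which each component, at the moment
it is taken, does not exceed in magnitude any nonzero component still pending in the OTHER list.
(Within its own list the order is kept; ties and zeros may be interleaved either way.) -/
inductive IsMerge : List ℚ → List ℚ → List ℚ → Prop
  | nil : IsMerge [] [] []
  | left {z : ℚ} {e f g : List ℚ} (hz : ∀ x ∈ f, x ≠ 0 → |z| ≤ |x|) (h : IsMerge g e f) :
      IsMerge (z :: g) (z :: e) f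
  | right {z : ℚ} {e f g : List ℚ} (hz : ∀ x ∈ e, x ≠ 0 → |z| ≤ |x|) (h : IsMerge g e f) :
      IsMerge (z :: g) e (z :: f)

/-- Admissibility is symmetric in the two inputs. -/
theorem IsMerge.swap {g e f : List ℚ} (h : IsMerge g e f) : IsMerge g f e := by
  induction h with
  | nil => exact IsMerge.nil
  | left hz _ ih => exact IsMerge.right hz ih
  | right hz _ ih => exact IsMerge.left hz ih

/-- A merge is a rearrangement of `e ++ f`. -/
theorem IsMerge.perm {g e f : List ℚ} (h : IsMerge g e f) : g.Perm (e ++ f) := by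
  induction h with
  | nil => exact List.Perm.refl _
  | left _ _ ih => exact ih.cons _
  | right _ _ ih => exact (ih.cons _).trans List.perm_middle.symm

/-- The components of a merge are the components of `e` and of `f`. -/
theorem IsMerge.mem_iff {g e f : List ℚ} (h : IsMerge g e f) {x : ℚ} : x ∈ g ↔ x ∈ e ++ f :=
  h.perm.mem_iff

/-- A merge has `m + n` components. -/
theorem IsMerge.length_eq {g e f : List ℚ} (h : IsMerge g e f) :
    g.length = e.length + f.length := by
  rw [h.perm.length_eq, List.length_append]

/-- A merge has sum `Σe + Σf`. -/
theorem IsMerge.sum_eq {g e f : List ℚ} (h : IsMerge g e f) : g.sum = e.sum + f.sum := by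
  rw [h.perm.sum_eq, List.sum_append]

/-- Appending all of `f` (nothing pending in `e`) is admissible. -/
theorem isMerge_nil_left (f : List ℚ) : IsMerge f [] f := by
  induction f with
  | nil => exact IsMerge.nil
  | cons y ys ih => exact IsMerge.right (fun x hx => by simp at hx) ih

/-- Appending all of `e` (nothing pending in `f`) is admissible. -/
theorem isMerge_nil_right (e : List ℚ) : IsMerge e e [] :=
  (isMerge_nil_left e).swap

/-- In an admissible merge of two lists sorted by magnitude except zeros, the first component does
not exceed the second in magnitude unless the second is zero (so Line 2 may use FAST-TWO-SUM). -/
theorem IsMerge.head_le {g₁ g₂ : ℚ} {gs e f : List ℚ} (h : IsMerge (g₁ :: g₂ :: gs) e f)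
    (he : e.Pairwise fun a b => b ≠ 0 → |a| ≤ |b|) (hf : f.Pairwise fun a b => b ≠ 0 → |a| ≤ |b|)
    (hg₂ : g₂ ≠ 0) : |g₁| ≤ |g₂| := by
  cases h with
  | @left _ e' _ _ hz h' =>
    cases h' with
    | left _ _ => exact (List.pairwise_cons.mp he).1 g₂ List.mem_cons_self hg₂
    | right _ _ => exact hz g₂ List.mem_cons_self hg₂
  | @right _ _ f' _ hz h' =>
    cases h' with
    | left _ _ => exact hz g₂ List.mem_cons_self hg₂
    | right _ _ => exact (List.pairwise_cons.mp hf).1 g₂ List.mem_cons_self hg₂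

/-- The tree's stable merge by magnitude (`e` first on ties) is admissible on inputs sorted by
magnitude except zeros. -/
theorem isMerge_mergeExpansions {e f : List ℚ}
    (he : e.Pairwise fun a b => b ≠ 0 → |a| ≤ |b|) (hf : f.Pairwise fun a b => b ≠ 0 → |a| ≤ |b|) :
    IsMerge (mergeExpansions e f) e f := by
  induction e generalizing f with
  | nil => rw [mergeExpansions_nil_left]; exact isMerge_nil_left f
  | cons x xs ihe =>
    induction f with
    | nil => rw [mergeExpansions_nil_right]; exact isMerge_nil_right _
    | cons y ys ihf =>
      rw [mergeExpansions_cons_cons]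
      by_cases hxy : |x| ≤ |y|
      · rw [if_pos hxy]
        refine IsMerge.left (fun w hw hw0 => ?_) (ihe (List.pairwise_cons.mp he).2 hf)
        rcases List.mem_cons.mp hw with rfl | hw
        · exact hxy
        · exact hxy.trans ((List.pairwise_cons.mp hf).1 w hw hw0)
      · rw [if_neg hxy]
        refine IsMerge.right (fun w hw hw0 => ?_) (ihf (List.pairwise_cons.mp hf).2)
        rcases List.mem_cons.mp hw with rfl | hw
        · exact (not_le.mp hxy).le
        · exact (not_le.mp hxy).le.trans ((List.pairwise_cons.mp he).1 w hw hw0)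

/-! ## Lines 2–5 on a given merged sequence -/

/-- Lines 2–5 of FAST-EXPANSION-SUM run on an already merged sequence `g`:
`(Q₂, h₁) ⇐ FAST-TWO-SUM(g₂, g₁)`, `(Qᵢ, hᵢ₋₁) ⇐ TWO-SUM(Qᵢ₋₁, gᵢ)` for `i ≥ 3`, `h_{m+n} ⇐ Q_{m+n}`
(for fewer than two components, `h = g`). -/
def fastExpansionSumOn (fl : ℚ → ℚ) : List ℚ → List ℚ
  | [] => []
  | [g₁] => [g₁]
  | g₁ :: g₂ :: gs => (fastTwoSum fl g₂ g₁).2 :: growExpansion fl gs (fastTwoSum fl g₂ g₁).1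

/-- The tree's FAST-EXPANSION-SUM is Lines 2–5 run on `mergeExpansions e f`. -/
theorem fastExpansionSum_eq_on (fl : ℚ → ℚ) (e f : List ℚ) :
    fastExpansionSum fl e f = fastExpansionSumOn fl (mergeExpansions e f) := by
  unfold fastExpansionSum
  rcases mergeExpansions e f with _ | ⟨g₁, _ | ⟨g₂, gs⟩⟩ <;> rfl

/-- On an admissible merge of float lists sorted by magnitude except zeros, Line 2's FAST-TWO-SUM
returns the same pair as TWO-SUM(g₁, g₂), so Lines 2–5 are the all-TWO-SUM chain
`GROW-EXPANSION(⟨g₂, g₃, …⟩, g₁)` — which is also what `predicates.c` computes when it uses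
`Two_Sum` for the second component (one input already exhausted). -/
theorem fastExpansionSumOn_eq_growExpansion (hp : 1 ≤ p) (hfl : IsRoundNearest p emin fl)
    {e f : List ℚ} (heF : ∀ x ∈ e, IsFloat p emin x) (hfF : ∀ x ∈ f, IsFloat p emin x)
    (he : e.Pairwise fun a b => b ≠ 0 → |a| ≤ |b|) (hf : f.Pairwise fun a b => b ≠ 0 → |a| ≤ |b|)
    {g₁ : ℚ} {gs : List ℚ} (hg : IsMerge (g₁ :: gs) e f) :
    fastExpansionSumOn fl (g₁ :: gs) = growExpansion fl gs g₁ := by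
  have hgF : ∀ x ∈ g₁ :: gs, IsFloat p emin x := fun x hx =>
    (List.mem_append.mp (hg.mem_iff.mp hx)).elim (heF x) (hfF x)
  cases gs with
  | nil => rfl
  | cons g₂ gs =>
    have h₁ : IsFloat p emin g₁ := hgF g₁ List.mem_cons_self
    have h₂ : IsFloat p emin g₂ := hgF g₂ (List.mem_cons_of_mem _ List.mem_cons_self)
    have hle : |g₁| ≤ |g₂| ∨ g₂ = 0 := by
      by_cases hg₂ : g₂ = 0
      · exact Or.inr hg₂
      · exact Or.inl (hg.head_le he hf hg₂)
    simp only [fastExpansionSumOn, growExpansion_cons,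
      fastTwoSum_eq_twoSum_of_abs_le hp hfl h₁ h₂ hle]

/-! ## The induction of Theorem 2 for an arbitrary admissible merge -/

/-- One loop step from a state whose pending components admit the merge `z :: rs`: process `z`
(from whichever input it comes) by `FesInvW.step`, keep an admissible merge `rs` of what remains,
and record the adjacency facts of a nonzero output (cf. `FesInvW.advance₂`). -/
theorem FesInvW.advanceM (hp : 4 ≤ p) (hfl : IsRoundNearest p emin fl) (hfl2 : RoundoffBelow 2 fl)
    {e f : List ℚ} (heF : ∀ x ∈ e, IsFloat p emin x) (hes : IsWeakExpansion e)
    (hfF : ∀ x ∈ f, IsFloat p emin x) (hfs : IsWeakExpansion f)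
    {z : ℚ} {rs e₁ f₁ e₂ f₂ : List ℚ} {Q : ℚ} {hs : List ℚ} {g : ℤ}
    (hm : IsMerge (z :: rs) e₂ f₂) (hI : FesInvW p emin e f e₁ f₁ e₂ f₂ Q hs g) :
    ∃ (e₁' f₁' e₂' f₂' : List ℚ) (g' : ℤ), IsMerge rs e₂' f₂' ∧
      FesInvW p emin e f e₁' f₁' e₂' f₂' (twoSum fl Q z).1 (hs ++ [(twoSum fl Q z).2]) g' ∧
      |(twoSum fl Q z).2| < (2 : ℚ) ^ g' ∧
      ((twoSum fl Q z).2 ≠ 0 → g' = Int.log 2 |(twoSum fl Q z).2| + 1 ∧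
        AdjFacts rs (twoSum fl Q z).1 (twoSum fl Q z).2 (Int.log 2 |(twoSum fl Q z).2|)) := by
  cases hm with
  | @left _ e₂' _ _ hzle hrest =>
    obtain ⟨g', hI', hlt, hg'⟩ := hI.step hp hfl heF hes hfF hfs hzle
    refine ⟨_, _, _, _, g', hrest, hI', hlt, fun hh0 => ⟨hg' hh0, ?_⟩⟩
    have hmem : ∀ x, x ∈ rs ↔ x ∈ e₂' ++ f₂ := fun x => hrest.mem_iff
    have hrg' : ∀ x ∈ e₂' ++ f₂, OnGrid (Int.log 2 |(twoSum fl Q z).2| + 1) x := fun x hx => by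
      rw [← hg' hh0]; exact hI'.inv.hrg x hx
    exact hI.adjFacts hp hfl hfl2 heF hes hfF hfs hzle hmem rfl rfl hh0 rfl hrg'
  | @right _ _ f₂' _ hzle hrest =>
    obtain ⟨g', hI', hlt, hg'⟩ := hI.swap.step hp hfl hfF hfs heF hes hzle
    refine ⟨_, _, _, _, g', hrest, hI'.swap, hlt, fun hh0 => ⟨hg' hh0, ?_⟩⟩
    have hmem : ∀ x, x ∈ rs ↔ x ∈ f₂' ++ e₂ := fun x => by
      rw [hrest.mem_iff, List.mem_append, List.mem_append, or_comm]
    have hrg' : ∀ x ∈ f₂' ++ e₂, OnGrid (Int.log 2 |(twoSum fl Q z).2| + 1) x := fun x hx => by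
      rw [← hg' hh0]; exact hI'.inv.hrg x hx
    exact hI.swap.adjFacts hp hfl hfl2 hfF hfs heF hes hzle hmem rfl rfl hh0 rfl hrg'

/-- The induction of Theorem 2 (`FesInvW.isWeakExpansion_growExpansion`) with the pending
components coupled to the rest of the run by an ARBITRARY admissible merge. -/
theorem FesInvW.isWeakExpansion_growExpansion_of_isMerge (hp : 4 ≤ p)
    (hfl : IsRoundNearest p emin fl) (hfl2 : RoundoffBelow 2 fl) {e f : List ℚ}
    (heF : ∀ x ∈ e, IsFloat p emin x) (hes : IsWeakExpansion e)
    (hfF : ∀ x ∈ f, IsFloat p emin x) (hfs : IsWeakExpansion f) :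
    ∀ (rs e₁ f₁ e₂ f₂ : List ℚ) (Q : ℚ) (hs : List ℚ) (g : ℤ), IsMerge rs e₂ f₂ →
      FesInvW p emin e f e₁ f₁ e₂ f₂ Q hs g →
      IsExpansion 1 (growExpansion fl rs Q) ∧ (growExpansion fl rs Q).Pairwise WeakBelow ∧
        (growExpansion fl rs Q).Triplewise NoDouble ∧
        (growExpansion fl rs Q).Pairwise (AdjW rs) := by
  have hp1 : 1 ≤ p := le_trans (by norm_num) hp
  have h2 : (0 : ℚ) < 2 := by norm_num
  intro rs
  induction rs with
  | nil =>
    intro e₁ f₁ e₂ f₂ Q hs g _ _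
    rw [growExpansion_nil]
    exact ⟨isExpansion_singleton 1 Q, List.pairwise_singleton _ _, List.triplewise_singleton _ _,
      List.pairwise_singleton _ _⟩
  | cons z rs ih =>
    intro e₁ f₁ e₂ f₂ Q hs g hm hI
    rw [growExpansion_cons]
    obtain ⟨e₁', f₁', e₂', f₂', g', hrs, hI', hlt, hfacts⟩ :=
      hI.advanceM hp hfl hfl2 heF hes hfF hfs hm
    set Q' := (twoSum fl Q z).1 with hQ'def
    set h := (twoSum fl Q z).2 with hhdef
    obtain ⟨hexp', hwb', hnd', hadj'⟩ := ih e₁' f₁' e₂' f₂' Q' _ g' hrs hI'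
    have hrsF : ∀ x ∈ rs, IsFloat p emin x := fun x hx => by
      rcases List.mem_append.mp (hrs.mem_iff.mp hx) with hx | hx
      · exact heF x (by rw [hI'.inv.he]; exact List.mem_append_right _ hx)
      · exact hfF x (by rw [hI'.inv.hf]; exact List.mem_append_right _ hx)
    have hrsG : ∀ x ∈ rs, OnGrid g' x := fun x hx => hI'.inv.hrg x (hrs.mem_iff.mp hx)
    have hQ'F : IsFloat p emin Q' := hI'.inv.hQ
    have hoF : ∀ w ∈ growExpansion fl rs Q', IsFloat p emin w :=
      isFloat_of_mem_growExpansion hfl hQ'F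
    have hb1 : ∀ w ∈ growExpansion fl rs Q', Below 1 h w := fun w hw =>
      ⟨g', onGrid_of_mem_growExpansion hp1 hfl hI'.inv.hg hQ'F hrsF hI'.inv.hQg hrsG w hw,
        by rw [one_mul]; exact hlt⟩
    -- if `h` is 2-below every later output, everything is immediate
    have easy : (∀ w ∈ growExpansion fl rs Q', Below 2 h w) →
        IsExpansion 1 (h :: growExpansion fl rs Q') ∧
          (h :: growExpansion fl rs Q').Pairwise WeakBelow ∧
          (h :: growExpansion fl rs Q').Triplewise NoDouble ∧
          (h :: growExpansion fl rs Q').Pairwise (AdjW (z :: rs)) := fun hb2 =>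
      ⟨isExpansion_cons.mpr ⟨hb1, hexp'⟩,
        List.pairwise_cons.mpr ⟨fun w hw => Or.inl (hb2 w hw), hwb'⟩,
        List.triplewise_cons.mpr ⟨hwb'.imp_of_mem fun ha _ _ => Or.inl (hb2 _ ha), hnd'⟩,
        List.pairwise_cons.mpr ⟨fun w hw hnb => absurd (hb2 w hw) hnb,
          hadj'.imp fun hab => hab.mono z⟩⟩
    by_cases hh0 : h = 0
    · exact easy fun w hw => hh0 ▸ below_zero_left (hoF w hw) 2
    obtain ⟨hg'eq, hF⟩ := hfacts hh0
    set T := Int.log 2 |h| with hTdef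
    have hTh : (2 : ℚ) ^ T ≤ |h| := zpow_log_le_abs hh0
    have hhT : |h| < (2 : ℚ) ^ (T + 1) := abs_lt_zpow_log_succ h
    have heT2 : emin ≤ T + 2 := by have := hI'.inv.hg; omega
    have hpT1 : (2 : ℚ) ^ (T + 1) = 2 * (2 : ℚ) ^ T := by rw [zpow_add_one₀ h2.ne']; ring
    have hpT2 : (2 : ℚ) ^ (T + 2) = 4 * (2 : ℚ) ^ T := by rw [zpow_add₀ h2.ne']; norm_num; ring
    rcases hF.dich with hall | ⟨habs, x₀, hx₀, M₀, hM₀, hx₀e⟩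
    · -- all later data on the grid `2^(T+2)`: `h` is 2-below every later output
      exact easy fun w hw => ⟨T + 2,
        onGrid_of_mem_growExpansion hp1 hfl heT2 hQ'F hrsF hF.gridQ hall w hw,
        by rw [hpT2]; rw [hpT1] at hhT; linarith⟩
    · -- `|h| = 2^T` with a witness `x₀`: weakly below everything; no double adjacency by §9
      refine ⟨isExpansion_cons.mpr ⟨hb1, hexp'⟩,
        List.pairwise_cons.mpr ⟨fun w hw => Or.inr ⟨hb1 w hw, T, habs⟩, hwb'⟩,
        List.triplewise_cons.mpr ⟨?_, hnd'⟩,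
        List.pairwise_cons.mpr ⟨fun w hw _ => ⟨x₀, List.mem_cons_of_mem z hx₀, M₀, hM₀, hx₀e⟩,
          hadj'.imp fun hab => hab.mono z⟩⟩
      refine (hwb'.and hadj').imp_of_mem fun {w₁ w₂} hw₁ _ hww => ?_
      obtain ⟨hwb, hadj⟩ := hww
      by_cases hb : Below 2 h w₁
      · exact Or.inl hb
      right
      by_contra hnb2
      have hw₁0 : w₁ ≠ 0 := fun h0 => hb (h0 ▸ below_zero_right 2 h)
      rcases hwb with hb2' | ⟨-, a, ha⟩
      · exact hnb2 hb2'
      obtain ⟨M₁, v₁, hM₁, -, -, hw₁e⟩ := exists_odd_mul_two_zpow (hoF w₁ hw₁) hw₁0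
      -- `w₁` is an odd multiple of exactly `2^(T+1)`, and a power of two: `|w₁| = 2^(T+1)`
      have hv1 : T + 1 ≤ v₁ := by
        obtain ⟨s, hs, hlt1⟩ := hb1 w₁ hw₁
        have hsv : s ≤ v₁ := OnGrid.le_of_odd hM₁ (by rwa [hw₁e] at hs)
        rw [one_mul, habs] at hlt1
        have := (zpow_lt_zpow_iff_right₀ (by norm_num : (1:ℚ) < 2)).mp
          (lt_of_lt_of_le hlt1 (zpow_le_zpow_right₀ (by norm_num) hsv))
        omega
      have hv2 : v₁ ≤ T + 1 := by
        by_contra hlt2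
        push Not at hlt2
        refine hb ⟨v₁, ⟨M₁, hw₁e⟩, ?_⟩
        rw [habs, ← hpT1]
        exact zpow_lt_zpow_right₀ (by norm_num) (by omega)
      have hv : v₁ = T + 1 := le_antisymm hv2 hv1
      rw [hw₁e] at ha
      obtain ⟨hM1abs, -⟩ := abs_eq_one_of_odd_of_abs_eq_two_zpow hM₁ ha
      have hlog : Int.log 2 |w₁| = T + 1 := by
        rw [hw₁e, abs_mul, abs_of_pos (zpow_pos h2 _),
          show |(M₁ : ℚ)| = 1 by exact_mod_cast hM1abs, one_mul, hv]
        have := Int.log_zpow (R := ℚ) (b := 2) (by norm_num) (T + 1)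
        exact_mod_cast this
      obtain ⟨y, hy, My, hMy, hye⟩ := hadj hnb2
      rw [hlog, show T + 1 + 1 = T + 2 by ring] at hye
      exact hF.noTwo x₀ hx₀ y hy M₀ My hM₀ hMy hx₀e hye

/-- **THEOREM 2′ (FAST-EXPANSION-SUM is correct for every admissible merge order).**  For any
precision `p ≥ 4` and any round-to-nearest rounding with `RoundoffBelow 2` (e.g. IEEE
round-half-even): if `e` and `f` are weakly nonoverlapping expansions of floats and `g` is ANY
admissible merge of them (`IsMerge g e f` — ties and zeros interleaved in any way), then Lines 2–5
run on `g` return a weakly nonoverlapping (hence nonoverlapping, increasing) expansion of `m + n`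
floats whose sum is `Σe + Σf` exactly. -/
theorem fastExpansionSumOn_spec (hp : 4 ≤ p) (hfl : IsRoundNearest p emin fl)
    (hfl2 : RoundoffBelow 2 fl) {e f g : List ℚ}
    (heF : ∀ x ∈ e, IsFloat p emin x) (hes : IsWeakExpansion e)
    (hfF : ∀ x ∈ f, IsFloat p emin x) (hfs : IsWeakExpansion f) (hg : IsMerge g e f) :
    IsWeakExpansion (fastExpansionSumOn fl g) ∧ (fastExpansionSumOn fl g).sum = e.sum + f.sum ∧
      (fastExpansionSumOn fl g).length = e.length + f.length ∧
      ∀ x ∈ fastExpansionSumOn fl g, IsFloat p emin x := by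
  have hp1 : 1 ≤ p := le_trans (by norm_num) hp
  have hgF : ∀ x ∈ g, IsFloat p emin x := fun x hx =>
    (List.mem_append.mp (hg.mem_iff.mp hx)).elim (heF x) (hfF x)
  have hmain := FesInvW.isWeakExpansion_growExpansion_of_isMerge hp hfl hfl2 heF hes hfF hfs
    g [] [] e f 0 [] emin hg (FesInvW.init heF hfF)
  cases g with
  | nil =>
    have hlen := hg.length_eq
    have hsum := hg.sum_eq
    simp only [List.length_nil] at hlen
    refine ⟨isWeakExpansion_nil, ?_, ?_, fun x hx => by simp [fastExpansionSumOn] at hx⟩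
    · simpa [fastExpansionSumOn] using hsum
    · simp only [fastExpansionSumOn, List.length_nil]; exact hlen
  | cons g₁ gs =>
    have h₁ : IsFloat p emin g₁ := hgF g₁ List.mem_cons_self
    have hgsF : ∀ x ∈ gs, IsFloat p emin x := fun x hx => hgF x (List.mem_cons_of_mem _ hx)
    rw [fastExpansionSumOn_eq_growExpansion hp1 hfl heF hfF hes.pairwise_abs_le
      hfs.pairwise_abs_le hg]
    rw [growExpansion_cons, twoSum_zero_left hfl h₁] at hmain
    refine ⟨⟨(List.pairwise_cons.mp hmain.2.1).2, (List.triplewise_cons.mp hmain.2.2.1).2⟩, ?_, ?_,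
      isFloat_of_mem_growExpansion hfl h₁⟩
    · rw [sum_growExpansion hp1 hfl h₁ hgsF, ← List.sum_cons, hg.sum_eq]
    · rw [length_growExpansion, ← hg.length_eq, List.length_cons]

/-- Theorems 1–2 of the development as the instance `g = mergeExpansions e f` of Theorem 2′. -/
theorem fastExpansionSum_spec_of_isWeakExpansion (hp : 4 ≤ p) (hfl : IsRoundNearest p emin fl)
    (hfl2 : RoundoffBelow 2 fl) {e f : List ℚ}
    (heF : ∀ x ∈ e, IsFloat p emin x) (hes : IsWeakExpansion e)
    (hfF : ∀ x ∈ f, IsFloat p emin x) (hfs : IsWeakExpansion f) :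
    IsWeakExpansion (fastExpansionSum fl e f) ∧ (fastExpansionSum fl e f).sum = e.sum + f.sum ∧
      (fastExpansionSum fl e f).length = e.length + f.length ∧
      ∀ x ∈ fastExpansionSum fl e f, IsFloat p emin x := by
  rw [fastExpansionSum_eq_on]
  exact fastExpansionSumOn_spec hp hfl hfl2 heF hes hfF hfs
    (isMerge_mergeExpansions hes.pairwise_abs_le hfs.pairwise_abs_le)

end Summit.Ventures.CertifiedArithmetic.Expansions
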